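import Summits.CriticalPhenomena.PercolationContinuityZ3.Theorems.PercNearOneGluingNoHeavyQuantLightTwoBlobCellsB
import Summits.CriticalPhenomena.PercolationContinuityZ3.Theorems.PercNearOneGluingNoHeavyQuantLightTwoBlobCellsA
import Summits.CriticalPhenomena.PercolationContinuityZ3.Theorems.PercNearOneGluingNoHeavyQuantLightTwoBlobCaseO
import Summits.CriticalPhenomena.PercolationContinuityZ3.Theorems.PercNearOneGluingNoHeavyQuantSliceLightBelow
import HarnessLib

/-!
# QUANT lane R8, T-DEC: the light two-blob law, sub-cases "a low" / "b low" — part 4: **`LawDec.LightTwoBlobDEC` HOLDS** — assembly of sub-cases O (`…QuantLightTwoBlobCaseO`, typer g22), "a low" and "b low"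

builds on p205010 (kernel theorem, internal audit signed; external expert review pending)

Support file (`--supports stmt-CriticalPhenomena-4575`), QUANT lane typer seat prim-quant-stmt (gen 23), rung R8 of
`run/shared/lean/prim/quant/LADDER.md`.  Theorems only, standard axioms, no sorries.

* `LawDec.lightTwoBlob_decAtT_bLow` / `lightTwoBlob_decAtT_aLow` — the two sub-cases with a low blob atom, by `twoBlob_decAtT_of_lowFlow`
  with the explicit capacity `F` and the cell lemmas `top_B*` / `top_A*`.
* **`LawDec.lightTwoBlobDEC_holds : LightTwoBlobDEC`** — the typed 4-atom statement of `…QuantSliceLightBelow` (p290740) is a theorem: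
  for `0 < x < 1`, `x² < γ < x ≤ g ≤ 1`, `a, b ≥ 1`, every layer `j″ ≥ a + b`, the law of `b·Bern(γ) + a·Bern(g)` is DEC(j″) at its ARCH credit
  `b(γ − x²)/(1 − x) + ag`.  (Exact LP census before the proof: 0 failures on > 10⁶ instances; certificate S1 = (I\*) on 300 000 adversarial ones.)
* **`LawDec.slice_decAtT_of_bdecAtT'`** — CONJECTURE SL (`LawDec.SliceClosed`) FROM THE LAYER-j′ DATUM ALONE FOR EVERY DATUM WITHOUT LIGHT
  STRADDLERS, now unconditional: `BDECAtT x T j′ M a μ → DECAtT x (T + a·g) j′ (M + a) (slice μ a g)` (`0 < x < 1`, `x ≤ g ≤ 1`, `a ≥ 1`).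
What remains of SL: only the light straddlers (`hi + a > j′ ≥ hi`, γ < x), where the second hypothesis (layer `j′ − a`) is consumed
(FOR-PROVERS-SL §4, LEAD-NOTES-G21 N46).

[this work]; DEC rules ARCH-TREES-G49 §2.2 / DEC-TAMP-G50 §3.1, flow normal form `…QuantLawDecFlows` (this lane).  The gluing rows served
[cite: KozmaNitzan2024, Conjecture 3 (p. 15)]; product measure [cite: Grimmett1999, §1.3 p. 10].
-/

noncomputable section

namespace Summit.CriticalPhenomena.PercolationContinuityZ3.Theorems

namespace Quant

open Finset

/-- the two-blob law `(1−u)(1−v)δ₀ + u(1−v)δ_a + (1−u)vδ_b + uvδ_{a+b}` evaluated at `h` (as in `…QuantBlobDecTwoLawParts`) -/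
local notation3 "LAW2[" a ", " u ", " b ", " v ", " h "]" =>
  (1 - (u : ℝ)) * (1 - (v : ℝ)) * (if (h : ℕ) = 0 then (1 : ℝ) else 0)
    + (u : ℝ) * (1 - (v : ℝ)) * (if (h : ℕ) = (a : ℕ) then (1 : ℝ) else 0)
    + (1 - (u : ℝ)) * (v : ℝ) * (if (h : ℕ) = (b : ℕ) then (1 : ℝ) else 0)
    + (u : ℝ) * (v : ℝ) * (if (h : ℕ) = (a : ℕ) + (b : ℕ) then (1 : ℝ) else 0)

namespace LawDec


/-! ### Sub-case "b low" -/

/-- **`LightTwoBlobDEC`, SUB-CASE "b LOW" (`2b < c`)**: for `0 < x < 1`, `x² < γ < x ≤ g ≤ 1`, `a, b ≥ 1`, `a + b ≤ j″` and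
`2b < c = b(γ − x²)/(1 − x) + ag`, the law `LAW2[b, γ; a, g]` is DEC(j″) at target `c` on `{0..b+a}`.  Certificate (I\*): `b ↦ a+b`
entirely; atom `0 ↦ a` to capacity (when `c < a`), the rest `↦ a+b`; the top inequality by the cells B1–B6. [this work] -/
theorem lightTwoBlob_decAtT_bLow (x γ g : ℝ) (a b j'' : ℕ) (hx0 : 0 < x) (hx1 : x < 1) (hγ0 : x ^ 2 < γ) (hγx : γ < x)
    (hxg : x ≤ g) (hg1 : g ≤ 1) (ha : 1 ≤ a) (hb : 1 ≤ b) (hj : a + b ≤ j'')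
    (h2b : 2 * (b : ℝ) < (b : ℝ) * ((γ - x ^ 2) / (1 - x)) + (a : ℝ) * g) :
    DECAtT x ((b : ℝ) * ((γ - x ^ 2) / (1 - x)) + (a : ℝ) * g) j'' (b + a) (fun h => LAW2[b, γ, a, g, h]) := by
  have h1x : (1 : ℝ) - x ≠ 0 := by linarith
  obtain ⟨κ, hγ⟩ : ∃ κ : ℝ, γ = x ^ 2 + (1 - x) * κ := ⟨(γ - x ^ 2) / (1 - x), by field_simp; ring⟩
  subst hγ
  have hκ : (x ^ 2 + (1 - x) * κ - x ^ 2) / (1 - x) = κ := by field_simp; ring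
  rw [hκ] at h2b ⊢
  have hk0 : 0 < κ := pos_of_mul_pos_right (by linarith : 0 < (1 - x) * κ) (by linarith)
  have hkx : κ < x := lt_of_mul_lt_mul_left (by nlinarith : (1 - x) * κ < (1 - x) * x) (by linarith)
  have ha0 : (0 : ℝ) < (a : ℝ) := by exact_mod_cast Nat.lt_of_lt_of_le Nat.zero_lt_one ha
  have hb0 : (0 : ℝ) < (b : ℝ) := by exact_mod_cast Nat.lt_of_lt_of_le Nat.zero_lt_one hb
  have hg0 : 0 < g := lt_of_lt_of_le hx0 hxg
  have hu0 : 0 ≤ x ^ 2 + (1 - x) * κ := by nlinarith [mul_pos (sub_pos.2 hx1) hk0]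
  have hu1 : x ^ 2 + (1 - x) * κ ≤ 1 := by nlinarith [mul_lt_mul_of_pos_left hkx (sub_pos.2 hx1)]
  have hT0 : 0 < (b : ℝ) * κ + (a : ℝ) * g := by nlinarith [mul_pos hb0 hk0, mul_pos ha0 hg0]
  have hsT : (b : ℝ) * κ + (a : ℝ) * g < (b : ℝ) + (a : ℝ) := by
    nlinarith [mul_pos hb0 (sub_pos.2 (hkx.trans hx1)), mul_nonneg ha0.le (sub_nonneg.2 hg1)]
  have hba : b < a := by exact_mod_cast (by linarith : (b : ℝ) < a)
  have hbaj : b + a ≤ j'' := by omega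
  have hxaT : x * (a : ℝ) ≤ (b : ℝ) * κ + (a : ℝ) * g := by nlinarith [mul_le_mul_of_nonneg_right hxg ha0.le, mul_pos hb0 hk0]
  -- light/heavy status of the two pairs into the top
  have hS : ∀ F : ℝ, (∀ (hTa : (b : ℝ) * κ + (a : ℝ) * g < (a : ℝ)), F = (1 - (x ^ 2 + (1 - x) * κ)) * g * ((a : ℝ) - ((b : ℝ) * κ + (a : ℝ) * g)) / ((b : ℝ) * κ + (a : ℝ) * g)) →
      (∀ (hTa : (a : ℝ) ≤ (b : ℝ) * κ + (a : ℝ) * g), F = 0) →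
      usage x ((b : ℝ) * κ + (a : ℝ) * g) j'' b (b + a) * ((x ^ 2 + (1 - x) * κ) * (1 - g))
        + usage x ((b : ℝ) * κ + (a : ℝ) * g) j'' 0 (b + a) * ((1 - (x ^ 2 + (1 - x) * κ)) * (1 - g) - F)
        ≤ (x ^ 2 + (1 - x) * κ) * g := by
    intro F hF1 hF2
    rcases lt_or_ge ((b : ℝ) * κ + (a : ℝ) * g) (a : ℝ) with hTa | hTa
    · rw [hF1 hTa]
      rcases le_or_gt ((b : ℝ) * κ + (a : ℝ) * g - 2 * (b : ℝ)) (x * (((b + a : ℕ) : ℝ) - (b : ℝ))) with hL1 | hH1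
      · rcases le_or_gt ((b : ℝ) * κ + (a : ℝ) * g) (x * ((b + a : ℕ) : ℝ)) with hL0 | hH0
        · exact top_B1 x κ g a b j'' hx0 hx1 hk0 hkx hxg hg1 ha hb hj h2b hTa hL1 hL0
        · exact top_B2 x κ g a b j'' hx0 hx1 hk0 hkx hxg hg1 ha hb hj h2b hTa hL1 hH0.le
      · have hH0 : x * ((b + a : ℕ) : ℝ) ≤ (b : ℝ) * κ + (a : ℝ) * g := by
          push_cast at hH1 ⊢; nlinarith [mul_lt_mul_of_pos_right hx1 hb0]
        exact top_B3 x κ g a b j'' hx0 hx1 hk0 hkx hxg hg1 ha hb hj h2b hTa hH1.le hH0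
    · rw [hF2 hTa]
      rcases le_or_gt ((b : ℝ) * κ + (a : ℝ) * g - 2 * (b : ℝ)) (x * (((b + a : ℕ) : ℝ) - (b : ℝ))) with hL1 | hH1
      · rcases le_or_gt ((b : ℝ) * κ + (a : ℝ) * g) (x * ((b + a : ℕ) : ℝ)) with hL0 | hH0
        · exact top_B4 x κ g a b j'' hx0 hx1 hk0 hkx hxg hg1 ha hb hj h2b hTa hL1 hL0
        · exact top_B5 x κ g a b j'' hx0 hx1 hk0 hkx hxg hg1 ha hb hj h2b hTa hL1 hH0.le
      · have hH0 : x * ((b + a : ℕ) : ℝ) ≤ (b : ℝ) * κ + (a : ℝ) * g := by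
          push_cast at hH1 ⊢; nlinarith [mul_lt_mul_of_pos_right hx1 hb0]
        exact top_B6 x κ g a b j'' hx0 hx1 hk0 hkx hxg hg1 ha hb hj h2b hTa hH1.le hH0
  by_cases hTa : (b : ℝ) * κ + (a : ℝ) * g < (a : ℝ)
  · -- atom 0 fills the mid `a` to capacity
    have haT : 0 < (a : ℝ) - ((b : ℝ) * κ + (a : ℝ) * g) := by linarith
    refine twoBlob_decAtT_of_lowFlow x (x ^ 2 + (1 - x) * κ) g _
      ((1 - (x ^ 2 + (1 - x) * κ)) * g * ((a : ℝ) - ((b : ℝ) * κ + (a : ℝ) * g)) / ((b : ℝ) * κ + (a : ℝ) * g))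
      b a j'' hx0 hx1 hu0 hu1 hg0.le hg1 hb hba hbaj h2b (by linarith) ?_ ?_ ?_
      (hS _ (fun _ => rfl) (fun h => absurd hTa (not_lt.2 h)))
    · exact div_nonneg (mul_nonneg (mul_nonneg (by linarith) hg0.le) haT.le) hT0.le
    · rw [div_le_iff₀ hT0]
      nlinarith [mul_nonneg (sub_nonneg.2 hu1) (mul_nonneg hb0.le hk0.le)]
    · intro _
      refine ⟨hTa, le_of_eq ?_⟩
      rw [usage0_eq_heavy x _ j'' a hx0 hx1 (by omega) hT0 hTa hxaT, div_mul_div_comm,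
        div_eq_iff (mul_ne_zero haT.ne' hT0.ne')]
      ring
  · push Not at hTa
    refine twoBlob_decAtT_of_lowFlow x (x ^ 2 + (1 - x) * κ) g _ 0 b a j'' hx0 hx1 hu0 hu1 hg0.le hg1 hb hba hbaj h2b
      (by linarith) le_rfl (mul_nonneg (by linarith) (by linarith)) (fun h => absurd h (lt_irrefl 0))
      (hS _ (fun h => absurd hTa (not_le.2 h)) (fun _ => rfl))

/-! ### Sub-case "a low" -/

/-- **`LightTwoBlobDEC`, SUB-CASE "a LOW" (`2a < c`)**: for `0 < x < 1`, `x² < γ < x ≤ g ≤ 1`, `a, b ≥ 1`, `a + b ≤ j″` and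
`2a < c = b(γ − x²)/(1 − x) + ag`, the law `LAW2[b, γ; a, g]` is DEC(j″) at target `c` on `{0..b+a}`.  Certificate (I\*) with the
blobs exchanged (`law2_swap`): `a ↦ a+b` entirely; atom `0 ↦ b` to capacity (when `c < b`, at the light or heavy minimal gate), the rest
`↦ a+b`; the top inequality by the cells A1–A5. [this work] -/
theorem lightTwoBlob_decAtT_aLow (x γ g : ℝ) (a b j'' : ℕ) (hx0 : 0 < x) (hx1 : x < 1) (hγ0 : x ^ 2 < γ) (hγx : γ < x)
    (hxg : x ≤ g) (hg1 : g ≤ 1) (ha : 1 ≤ a) (hb : 1 ≤ b) (hj : a + b ≤ j'')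
    (h2a : 2 * (a : ℝ) < (b : ℝ) * ((γ - x ^ 2) / (1 - x)) + (a : ℝ) * g) :
    DECAtT x ((b : ℝ) * ((γ - x ^ 2) / (1 - x)) + (a : ℝ) * g) j'' (b + a) (fun h => LAW2[b, γ, a, g, h]) := by
  have h1x : (1 : ℝ) - x ≠ 0 := by linarith
  obtain ⟨κ, hγ⟩ : ∃ κ : ℝ, γ = x ^ 2 + (1 - x) * κ := ⟨(γ - x ^ 2) / (1 - x), by field_simp; ring⟩
  subst hγ
  have hκ : (x ^ 2 + (1 - x) * κ - x ^ 2) / (1 - x) = κ := by field_simp; ring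
  rw [hκ] at h2a ⊢
  have hk0 : 0 < κ := pos_of_mul_pos_right (by linarith : 0 < (1 - x) * κ) (by linarith)
  have hkx : κ < x := lt_of_mul_lt_mul_left (by nlinarith : (1 - x) * κ < (1 - x) * x) (by linarith)
  have ha0 : (0 : ℝ) < (a : ℝ) := by exact_mod_cast Nat.lt_of_lt_of_le Nat.zero_lt_one ha
  have hb0 : (0 : ℝ) < (b : ℝ) := by exact_mod_cast Nat.lt_of_lt_of_le Nat.zero_lt_one hb
  have hg0 : 0 < g := lt_of_lt_of_le hx0 hxg
  have hu0 : 0 ≤ x ^ 2 + (1 - x) * κ := by nlinarith [mul_pos (sub_pos.2 hx1) hk0]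
  have hu1 : x ^ 2 + (1 - x) * κ ≤ 1 := by nlinarith [mul_lt_mul_of_pos_left hkx (sub_pos.2 hx1)]
  have hux : x ^ 2 + (1 - x) * κ < x := by nlinarith [mul_lt_mul_of_pos_left hkx (sub_pos.2 hx1)]
  have hT0 : 0 < (b : ℝ) * κ + (a : ℝ) * g := by nlinarith [mul_pos hb0 hk0, mul_pos ha0 hg0]
  have hsT : (b : ℝ) * κ + (a : ℝ) * g < (b : ℝ) + (a : ℝ) := by
    nlinarith [mul_pos hb0 (sub_pos.2 (hkx.trans hx1)), mul_nonneg ha0.le (sub_nonneg.2 hg1)]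
  have hab : a < b := by exact_mod_cast (by linarith : (a : ℝ) < b)
  have hbkT : (b : ℝ) * κ ≤ (b : ℝ) * κ + (a : ℝ) * g := by nlinarith [mul_pos ha0 hg0]
  rw [law2_swap a b, Nat.add_comm b a]
  -- the top inequality, by cells
  have hS : ∀ F : ℝ,
      (∀ (hTbx : (b : ℝ) * κ + (a : ℝ) * g ≤ x * (b : ℝ)), F = (1 - g) * (x ^ 2 + (1 - x) * κ)
          * ((1 - x) * ((1 + x) * (b : ℝ) - ((b : ℝ) * κ + (a : ℝ) * g))) / (x ^ 2 * (b : ℝ) + (1 - x) * ((b : ℝ) * κ + (a : ℝ) * g))) →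
      (∀ (hbx : x * (b : ℝ) < (b : ℝ) * κ + (a : ℝ) * g) (hTb : (b : ℝ) * κ + (a : ℝ) * g < (b : ℝ)),
          F = (1 - g) * (x ^ 2 + (1 - x) * κ) * ((b : ℝ) - ((b : ℝ) * κ + (a : ℝ) * g)) / ((b : ℝ) * κ + (a : ℝ) * g)) →
      (∀ (hTb : (b : ℝ) ≤ (b : ℝ) * κ + (a : ℝ) * g), F = 0) →
      usage x ((b : ℝ) * κ + (a : ℝ) * g) j'' a (a + b) * (g * (1 - (x ^ 2 + (1 - x) * κ)))
        + usage x ((b : ℝ) * κ + (a : ℝ) * g) j'' 0 (a + b) * ((1 - g) * (1 - (x ^ 2 + (1 - x) * κ)) - F)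
        ≤ g * (x ^ 2 + (1 - x) * κ) := by
    intro F hF1 hF2 hF3
    rcases lt_or_ge ((b : ℝ) * κ + (a : ℝ) * g) (b : ℝ) with hTb | hTb
    · rcases le_or_gt ((b : ℝ) * κ + (a : ℝ) * g) (x * (b : ℝ)) with hTbx | hbx
      · have hL0 : (b : ℝ) * κ + (a : ℝ) * g ≤ x * ((a + b : ℕ) : ℝ) := by push_cast; nlinarith [mul_pos hx0 ha0]
        rw [hF1 hTbx]
        exact top_A1 x κ g a b j'' hx0 hx1 hk0 hkx hxg hg1 ha hb hj h2a hTbx hL0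
      · rw [hF2 hbx hTb]
        rcases le_or_gt ((b : ℝ) * κ + (a : ℝ) * g) (x * ((a + b : ℕ) : ℝ)) with hL0 | hH0
        · exact top_A2 x κ g a b j'' hx0 hx1 hk0 hkx hxg hg1 ha hb hj h2a hbx.le hTb hL0
        · exact top_A3 x κ g a b j'' hx0 hx1 hk0 hkx hxg hg1 ha hb hj h2a hbx.le hTb hH0.le
    · rw [hF3 hTb]
      rcases le_or_gt ((b : ℝ) * κ + (a : ℝ) * g) (x * ((a + b : ℕ) : ℝ)) with hL0 | hH0
      · exact top_A4 x κ g a b j'' hx0 hx1 hk0 hkx hxg hg1 ha hb hj h2a hTb hL0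
      · exact top_A5 x κ g a b j'' hx0 hx1 hk0 hkx hxg hg1 ha hb hj h2a hTb hH0.le
  by_cases hTb : (b : ℝ) * κ + (a : ℝ) * g < (b : ℝ)
  · have hbT : 0 < (b : ℝ) - ((b : ℝ) * κ + (a : ℝ) * g) := by linarith
    by_cases hTbx : (b : ℝ) * κ + (a : ℝ) * g ≤ x * (b : ℝ)
    · -- atom 0 fills the mid `b` at the LIGHT minimal gate
      have hFd : 0 < x ^ 2 * (b : ℝ) + (1 - x) * ((b : ℝ) * κ + (a : ℝ) * g) := by nlinarith [mul_pos (pow_pos hx0 2) hb0]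
      have hFn : 0 < (1 - x) * ((1 + x) * (b : ℝ) - ((b : ℝ) * κ + (a : ℝ) * g)) := by
        apply mul_pos (sub_pos.2 hx1); nlinarith [mul_pos hx0 hb0]
      refine twoBlob_decAtT_of_lowFlow x g (x ^ 2 + (1 - x) * κ) _
        ((1 - g) * (x ^ 2 + (1 - x) * κ) * ((1 - x) * ((1 + x) * (b : ℝ) - ((b : ℝ) * κ + (a : ℝ) * g)))
          / (x ^ 2 * (b : ℝ) + (1 - x) * ((b : ℝ) * κ + (a : ℝ) * g)))
        a b j'' hx0 hx1 hg0.le hg1 hu0 hu1 ha hab hj h2a (by linarith) ?_ ?_ ?_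
        (hS _ (fun _ => rfl) (fun h _ => absurd hTbx (not_le.2 h)) (fun h => absurd hTb (not_lt.2 h)))
      · exact div_nonneg (mul_nonneg (mul_nonneg (by linarith) hu0) hFn.le) hFd.le
      · rw [div_le_iff₀ hFd]
        nlinarith [mul_nonneg (sub_nonneg.2 hg1) (mul_nonneg (sub_nonneg.2 hx1.le) (sub_nonneg.2 hbkT))]
      · intro _
        refine ⟨hTb, le_of_eq ?_⟩
        rw [usage0_eq_light x _ j'' b hx0 hx1 (by omega) hT0 hTb hTbx, div_mul_div_comm,
          div_eq_iff (mul_ne_zero hFn.ne' hFd.ne')]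
        ring
    · -- atom 0 fills the mid `b` at the HEAVY minimal gate
      push Not at hTbx
      refine twoBlob_decAtT_of_lowFlow x g (x ^ 2 + (1 - x) * κ) _
        ((1 - g) * (x ^ 2 + (1 - x) * κ) * ((b : ℝ) - ((b : ℝ) * κ + (a : ℝ) * g)) / ((b : ℝ) * κ + (a : ℝ) * g))
        a b j'' hx0 hx1 hg0.le hg1 hu0 hu1 ha hab hj h2a (by linarith) ?_ ?_ ?_
        (hS _ (fun h => absurd hTbx (not_lt.2 h)) (fun _ _ => rfl) (fun h => absurd hTb (not_lt.2 h)))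
      · exact div_nonneg (mul_nonneg (mul_nonneg (by linarith) hu0) hbT.le) hT0.le
      · rw [div_le_iff₀ hT0]
        nlinarith [mul_nonneg (sub_nonneg.2 hg1) (sub_nonneg.2 hTbx.le), mul_lt_mul_of_pos_right hux hb0]
      · intro _
        refine ⟨hTb, le_of_eq ?_⟩
        rw [usage0_eq_heavy x _ j'' b hx0 hx1 (by omega) hT0 hTb hTbx.le, div_mul_div_comm,
          div_eq_iff (mul_ne_zero hbT.ne' hT0.ne')]
        ring
  · push Not at hTb
    refine twoBlob_decAtT_of_lowFlow x g (x ^ 2 + (1 - x) * κ) _ 0 a b j'' hx0 hx1 hg0.le hg1 hu0 hu1 ha hab hj h2a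
      (by linarith) le_rfl (mul_nonneg (by linarith) (by linarith)) (fun h => absurd h (lt_irrefl 0))
      (hS _ (fun h => absurd hTb (not_le.2 (by nlinarith [mul_lt_mul_of_pos_right hx1 hb0]))) (fun _ h => absurd hTb (not_le.2 h))
        (fun _ => rfl))

/-! ### The typed conjecture -/

/-- **`LawDec.LightTwoBlobDEC` HOLDS** (the typed 4-atom statement of `…QuantSliceLightBelow`, p290740): for `0 < x < 1`,
`x² < γ < x ≤ g ≤ 1`, `a, b ≥ 1` and every layer `j″ ≥ a + b`, the law of `b·Bern(γ) + a·Bern(g)` is DEC(j″) at its credit target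
`b(γ − x²)/(1 − x) + ag`.  Sub-case O (only atom `0` low) is `lightTwoBlob_decAtT_caseO` (`…QuantLightTwoBlobCaseO`, typer g22); the
sub-cases "a low" / "b low" are `lightTwoBlob_decAtT_aLow` / `_bLow` above. [this work] -/
theorem lightTwoBlobDEC_holds : LightTwoBlobDEC := by
  intro x γ g a b j'' hx0 hx1 hγ0 hγx hxg hg1 ha hb hj
  by_cases h2a : 2 * (a : ℝ) < (b : ℝ) * ((γ - x ^ 2) / (1 - x)) + (a : ℝ) * g
  · exact lightTwoBlob_decAtT_aLow x γ g a b j'' hx0 hx1 hγ0 hγx hxg hg1 ha hb hj h2a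
  · by_cases h2b : 2 * (b : ℝ) < (b : ℝ) * ((γ - x ^ 2) / (1 - x)) + (a : ℝ) * g
    · exact lightTwoBlob_decAtT_bLow x γ g a b j'' hx0 hx1 hγ0 hγx hxg hg1 ha hb hj h2b
    · exact lightTwoBlob_decAtT_caseO x γ g a b j'' hx0 hx1 hγ0 hγx hxg hg1 ha hb hj (not_lt.1 h2a) (not_lt.1 h2b)

/-- **SL WITH ONE HYPOTHESIS FOR EVERY DATUM WITHOUT LIGHT STRADDLERS — now unconditional** (`slice_decAtT_of_bdecAtT` of
`…QuantSliceLightBelow` with `LightTwoBlobDEC` discharged): floor `0 < x < 1`, blob `(a ≥ 1, x ≤ g ≤ 1)`,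
`BDECAtT x T j′ M a μ → DECAtT x (T + a·g) j′ (M + a) (slice μ a g)`. [this work] -/
theorem slice_decAtT_of_bdecAtT' (x T g : ℝ) (j' M a : ℕ) (μ : ℕ → ℝ) (hx0 : 0 < x) (hx1 : x < 1) (hxg : x ≤ g)
    (hg1 : g ≤ 1) (ha : 1 ≤ a) (h : BDECAtT x T j' M a μ) : DECAtT x (T + (a : ℝ) * g) j' (M + a) (slice μ a g) :=
  slice_decAtT_of_bdecAtT lightTwoBlobDEC_holds x T g j' M a μ hx0 hx1 hxg hg1 ha h

end LawDec

end Quant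

end Summit.CriticalPhenomena.PercolationContinuityZ3.Theorems
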